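import Summits.QuantumFields.YangMills.Theorems.EquipartitionCriticalitySubgradientLogSqueeze
import Literature.MathematicalPhysics.QuantumFieldTheory.YangMillsOS
import Literature.MathematicalPhysics.QuantumFieldTheory.WilsonEnergyConvexity
import Literature.MathematicalPhysics.QuantumFieldTheory.LatticeGaugeProofs
import Literature.MathematicalPhysics.QuantumLattice.LatticeGaugeDLRFreeEnergyProofs
import HarnessLib

/-!
# Stub `stub_equipartition` of line Sketch (crux stmt-QuantumFields-8760)

Equipartition of the plaquette energy, uniformly over torus-limit states: for a compact group
`G` with a faithful continuous unitary lattice representation `r`, IF the torus free energy per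
site `f(β) = freeEnergyDensity 4 r.ρ β` of 4-D Wilson lattice gauge theory satisfies
`f(β) + c log β → K` with `c = 3D/2` (`D` the dimension of the Lie algebra of `r(G)`), THEN for
every `ε > 0`, eventually in `β`, every torus-limit state `μ ∈ infiniteVolumeLimitPoints r.ρ β`
has `|β · E_μ[s₀] - c| < ε`, where `s₀(U) = ∑_{i<j} (N - Re tr r(U_{0,ij}))` is the Wilson energy
of the six plaquettes based at the origin.

Proof (Griffiths' lemma + the landed `SubgradientLogSqueeze`):

* (`Equipartition.wilsonExpectation_wilsonAction_eq`) on the torus of side `M`, translation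
  invariance of the Wilson state (`wilsonExpectation_comp_torusConfigShift`,
  `plaquetteHolonomy_torusConfigShift`) gives `⟨S⟩_{M,β} = M^d ⟨s₀ ∘ torusLift⟩_{M,β}` (the
  Wilson action is the sum over sites of the translated site energies);
* (`Equipartition.supportingLine`) the Gibbs–Jensen supporting-line inequality
  `(β - y) ⟨S⟩_{M,β} ≤ log Z_M(y) - log Z_M(β)` (`mul_wilsonExpectation_wilsonAction_le`), divided
  by `M^d`, reads `(β - y) ⟨s₀ ∘ torusLift⟩_{M,β} ≤ f_M(y) - f_M(β)`;
* (`Equipartition.griffiths`) along the subsequence of tori defining `μ` the left side tends to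
  `(β - y) E_μ[s₀]` (`s₀` is a bounded continuous cylinder observable) and the right side to
  `f(y) - f(β)` (`exists_hasFreeEnergyDensity_holds`), so `-E_μ[s₀]` is a subgradient of `f` at
  `β` (Griffiths 1966 / Ruelle 1969: limit energy densities are subgradients of the pressure);
* (`stub_equipartition`) `subgradientLogSqueeze_proof` with `ε/2` gives `|β(-E_μ[s₀]) + c| ≤ ε/2`
  eventually in `β`, uniformly in `μ`.
-/

noncomputable section

namespace Summit.QuantumFields.YangMills.Theorems.EquipartitionPinsProbe.Equipartition

open MeasureTheory Filter Topology
open Literature.MathematicalPhysics.QuantumLattice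
open Literature.MathematicalPhysics.QuantumFieldTheory

variable {d N : ℕ} {G : Type*} [Group G] (ρ : G →* Matrix (Fin N) (Fin N) ℂ)

/-! ### Bookkeeping: the Wilson action as a sum of translated site energies -/

omit [Group G] in
/-- The site energy `∑_{i<j} (N - Re tr ρ(g i j))` is bounded by `∑_{i,j} (N + B)` when
`|Re tr ρ| ≤ B`. -/
theorem abs_siteSum_le {ρ : G → Matrix (Fin N) (Fin N) ℂ} {B : ℝ} (hB0 : 0 ≤ B)
    (hB : ∀ g, |(ρ g).trace.re| ≤ B) (g : Fin d → Fin d → G) :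
    |∑ i : Fin d, ∑ j : Fin d, (if i < j then ((N : ℝ) - (ρ (g i j)).trace.re) else 0)| ≤
      ∑ _i : Fin d, ∑ _j : Fin d, ((N : ℝ) + B) := by
  refine (Finset.abs_sum_le_sum_abs _ _).trans (Finset.sum_le_sum fun i _ => ?_)
  refine (Finset.abs_sum_le_sum_abs _ _).trans (Finset.sum_le_sum fun j _ => ?_)
  split_ifs
  · refine (abs_sub _ _).trans ?_
    rw [Nat.abs_cast]
    exact add_le_add le_rfl (hB _)
  · rw [abs_zero]
    exact add_nonneg (Nat.cast_nonneg _) hB0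

omit [Group G] in
/-- The sum over the planes `{(i, j) // i < j}` is the double sum with the indicator `i < j`. -/
theorem sum_planes (g : Fin d → Fin d → ℝ) :
    ∑ q : {p : Fin d × Fin d // p.1 < p.2}, g q.1.1 q.1.2 =
      ∑ i : Fin d, ∑ j : Fin d, if i < j then g i j else 0 := by
  rw [← Fintype.sum_prod_type', ← Finset.sum_filter]
  exact (Finset.sum_subtype _ (fun _ => by simp) fun p : Fin d × Fin d => g p.1 p.2).symm

/-- The Wilson action of the torus is the sum over sites `x` of the site energies
`∑_{i<j} (N - Re tr ρ(U_{x,ij}))`. -/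
theorem wilsonAction_eq_sum_site {M : ℕ} [NeZero M] (U : GaugeConfig d M G) :
    wilsonAction ρ U = ∑ x : Site d M, ∑ i : Fin d, ∑ j : Fin d,
      if i < j then ((N : ℝ) - (ρ (plaquetteHolonomy U x i j)).trace.re) else 0 := by
  rw [wilsonAction, Fintype.sum_prod_type]
  exact Finset.sum_congr rfl fun x _ =>
    sum_planes fun i j => (N : ℝ) - (ρ (plaquetteHolonomy U x i j)).trace.re

/-- The number of sites of the torus `(ℤ/Mℤ)^d` is `M^d`. -/
theorem card_site (M : ℕ) [NeZero M] : Fintype.card (Site d M) = M ^ d := by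
  rw [Fintype.card_fun, ZMod.card, Fintype.card_fin]

variable [TopologicalSpace G] [IsTopologicalGroup G] [CompactSpace G] [MeasurableSpace G]
  [BorelSpace G]

/-- The site energy at `x` is integrable for the torus Wilson state (bounded and measurable;
continuous `ρ`, second countable `G`). -/
theorem integrable_siteEnergy [SecondCountableTopology G] (hρ : Continuous ρ) (β : ℝ) {M : ℕ}
    [NeZero M] (x : Site d M) :
    Integrable (fun U : GaugeConfig d M G => ∑ i : Fin d, ∑ j : Fin d,
      if i < j then ((N : ℝ) - (ρ (plaquetteHolonomy U x i j)).trace.re) else 0)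
      (wilsonMeasure ρ β) := by
  haveI := isProbabilityMeasure_wilsonMeasure (d := d) (L := M) (G := G) ρ hρ β
  obtain ⟨B, hB0, hB⟩ := exists_bound_trace_re_nonneg ρ hρ
  refine Integrable.of_bound ?_ (∑ _i : Fin d, ∑ _j : Fin d, ((N : ℝ) + B))
    (ae_of_all _ fun U => ?_)
  · refine (Finset.measurable_sum _ fun i _ => Finset.measurable_sum _ fun j _ => ?_)
      |>.aestronglyMeasurable
    split_ifs
    · exact measurable_const.sub
        ((continuous_trace_re ρ hρ).measurable.comp (measurable_plaquetteHolonomy x i j))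
    · exact measurable_const
  · rw [Real.norm_eq_abs]
    exact abs_siteSum_le hB0 hB fun i j => plaquetteHolonomy U x i j

/-- **Translation invariance**: the mean Wilson action of the torus of side `M` is `M^d` times the
mean site energy at the origin. -/
theorem wilsonExpectation_wilsonAction_eq [SecondCountableTopology G] (hρ : Continuous ρ) (β : ℝ)
    (M : ℕ) [NeZero M] :
    wilsonExpectation ρ β (wilsonAction (d := d) (L := M) (G := G) ρ) =
      (M : ℝ) ^ d * wilsonExpectation (d := d) (L := M) ρ β (fun U => ∑ i : Fin d, ∑ j : Fin d,
        if i < j then ((N : ℝ) - (ρ (plaquetteHolonomy U 0 i j)).trace.re) else 0) := by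
  have hshift : ∀ x : Site d M, wilsonExpectation (d := d) (L := M) ρ β
      (fun U => ∑ i : Fin d, ∑ j : Fin d,
        if i < j then ((N : ℝ) - (ρ (plaquetteHolonomy U x i j)).trace.re) else 0) =
      wilsonExpectation (d := d) (L := M) ρ β (fun U => ∑ i : Fin d, ∑ j : Fin d,
        if i < j then ((N : ℝ) - (ρ (plaquetteHolonomy U 0 i j)).trace.re) else 0) := by
    intro x
    refine Eq.trans ?_ (wilsonExpectation_comp_torusConfigShift ρ β (-x) _)
    congr 1
    funext U
    simp only [Function.comp_apply, plaquetteHolonomy_torusConfigShift, zero_sub, neg_neg]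
  calc wilsonExpectation ρ β (wilsonAction (d := d) (L := M) (G := G) ρ)
      = ∫ U, ∑ x : Site d M, (∑ i : Fin d, ∑ j : Fin d,
          if i < j then ((N : ℝ) - (ρ (plaquetteHolonomy U x i j)).trace.re) else 0)
          ∂(wilsonMeasure ρ β) := by
        simp only [wilsonExpectation, wilsonAction_eq_sum_site]
    _ = ∑ x : Site d M, wilsonExpectation (d := d) (L := M) ρ β
          (fun U => ∑ i : Fin d, ∑ j : Fin d,
            if i < j then ((N : ℝ) - (ρ (plaquetteHolonomy U x i j)).trace.re) else 0) :=
        integral_finsetSum _ fun x _ => integrable_siteEnergy ρ hρ β x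
    _ = ∑ _x : Site d M, wilsonExpectation (d := d) (L := M) ρ β
          (fun U => ∑ i : Fin d, ∑ j : Fin d,
            if i < j then ((N : ℝ) - (ρ (plaquetteHolonomy U 0 i j)).trace.re) else 0) :=
        Finset.sum_congr rfl fun x _ => hshift x
    _ = _ := by
        rw [Finset.sum_const, Finset.card_univ, card_site, nsmul_eq_mul, Nat.cast_pow]

/-! ### The site energy at the origin of `ℤ^d` as a bounded continuous cylinder observable -/

omit [TopologicalSpace G] [IsTopologicalGroup G] [CompactSpace G] [MeasurableSpace G]
  [BorelSpace G] in
/-- The site energy at the origin is a cylinder observable, supported on the edges of the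
plaquettes based at the origin. -/
theorem isCylinder_siteEnergy :
    IsCylinder (fun U : LGConfig d G => ∑ i : Fin d, ∑ j : Fin d,
        if i < j then ((N : ℝ) - plaquetteObs ρ 0 i j U) else 0)
      (Finset.univ.biUnion fun p : Fin d × Fin d => originPlaquetteSupport p.1 p.2) := by
  intro U V h
  refine Finset.sum_congr rfl fun i _ => Finset.sum_congr rfl fun j _ => ?_
  by_cases hij : i < j <;> simp only [hij, ↓reduceIte]
  rw [isCylinder_plaquetteObs_zero ρ i j
    (fun e he => h e (Finset.mem_biUnion.2 ⟨(i, j), Finset.mem_univ _, he⟩))]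

omit [CompactSpace G] [MeasurableSpace G] [BorelSpace G] in
/-- The site energy at the origin is continuous (continuous `ρ`). -/
theorem continuous_siteEnergy (hρ : Continuous ρ) :
    Continuous (fun U : LGConfig d G => ∑ i : Fin d, ∑ j : Fin d,
        if i < j then ((N : ℝ) - plaquetteObs ρ 0 i j U) else 0) := by
  refine continuous_finsetSum _ fun i _ => continuous_finsetSum _ fun j _ => ?_
  by_cases hij : i < j <;> simp only [hij, ↓reduceIte]
  exacts [continuous_const.sub (continuous_plaquetteObs ρ hρ 0 i j), continuous_const]

omit [IsTopologicalGroup G] [MeasurableSpace G] [BorelSpace G] in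
/-- The site energy at the origin is bounded (compact `G`, continuous `ρ`). -/
theorem exists_abs_siteEnergy_le (hρ : Continuous ρ) :
    ∃ C : ℝ, ∀ U : LGConfig d G, |∑ i : Fin d, ∑ j : Fin d,
        (if i < j then ((N : ℝ) - plaquetteObs ρ 0 i j U) else 0)| ≤ C := by
  obtain ⟨B, hB0, hB⟩ := exists_bound_trace_re_nonneg ρ hρ
  exact ⟨_, fun U => abs_siteSum_le hB0 hB fun i j => plaquetteHolonomyZd U 0 i j⟩

omit [Group G] [TopologicalSpace G] [IsTopologicalGroup G] [CompactSpace G] [MeasurableSpace G]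
  [BorelSpace G] in
/-- The origin of `ℤ^d` projects to the origin of the torus. -/
theorem torusProj_zero (M : ℕ) :
    Literature.Probability.LatticeModels.Torus.proj M
      (0 : Literature.Probability.LatticeModels.Site d) = (0 : Site d M) := by
  funext i
  simp

omit [TopologicalSpace G] [IsTopologicalGroup G] [CompactSpace G] [MeasurableSpace G]
  [BorelSpace G] in
/-- Read on periodic configurations, the site energy at the origin of `ℤ^d` is the torus site
energy at the origin. -/
theorem toTorusObservable_siteEnergy (M : ℕ) :
    toTorusObservable M (fun U : LGConfig d G => ∑ i : Fin d, ∑ j : Fin d,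
        if i < j then ((N : ℝ) - plaquetteObs ρ 0 i j U) else 0) =
      fun U : GaugeConfig d M G => ∑ i : Fin d, ∑ j : Fin d,
        if i < j then ((N : ℝ) - (ρ (plaquetteHolonomy U 0 i j)).trace.re) else 0 := by
  funext U
  simp only [toTorusObservable_apply, plaquetteObs, FreeEnergy.plaquetteHolonomyZd_torusLift,
    torusProj_zero]

/-! ### Griffiths' lemma: torus-limit energy densities are subgradients of the pressure -/

/-- **The supporting line, per site.** On the torus of side `M`,
`(β - y) ⟨s₀ ∘ torusLift⟩_{M,β} ≤ M^{-d} log Z_M(y) - M^{-d} log Z_M(β)` (Gibbs–Jensen divided by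
the volume, using translation invariance). -/
theorem supportingLine [SecondCountableTopology G] (hρ : Continuous ρ) (β y : ℝ) (M : ℕ)
    [NeZero M] :
    (β - y) * wilsonExpectation ρ β (toTorusObservable M fun U : LGConfig d G =>
        ∑ i : Fin d, ∑ j : Fin d, if i < j then ((N : ℝ) - plaquetteObs ρ 0 i j U) else 0) ≤
      ((M : ℝ) ^ d)⁻¹ * torusLogPartition d ρ y M -
        ((M : ℝ) ^ d)⁻¹ * torusLogPartition d ρ β M := by
  have hM : (0 : ℝ) < (M : ℝ) ^ d := pow_pos (Nat.cast_pos.2 (Nat.pos_of_ne_zero (NeZero.ne M))) d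
  have hGJ := mul_wilsonExpectation_wilsonAction_le (d := d) (L := M) (G := G) ρ hρ β y
  rw [wilsonExpectation_wilsonAction_eq ρ hρ β M] at hGJ
  rw [toTorusObservable_siteEnergy ρ M]
  refine le_of_mul_le_mul_left ?_ hM
  rw [mul_left_comm, mul_sub, mul_inv_cancel_left₀ hM.ne', mul_inv_cancel_left₀ hM.ne']
  exact hGJ

/-- **Griffiths' lemma.** For every torus-limit state `μ` at inverse coupling `β` and every `y`,
`(β - y) E_μ[s₀] ≤ f(y) - f(β)`: `-E_μ[s₀]` is a subgradient at `β` of the free energy density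
`f = freeEnergyDensity d ρ` (limit of the per-site supporting lines along the tori defining `μ`). -/
theorem griffiths [SecondCountableTopology G] (hρ : Continuous ρ) {β : ℝ}
    {μ : Measure (LGConfig d G)} (hμ : μ ∈ infiniteVolumeLimitPoints ρ β) (y : ℝ) :
    (β - y) * ∫ U, (∑ i : Fin d, ∑ j : Fin d,
        if i < j then ((N : ℝ) - plaquetteObs ρ 0 i j U) else 0) ∂μ ≤
      freeEnergyDensity d ρ y - freeEnergyDensity d ρ β := by
  obtain ⟨L, hL, hμL⟩ := hμ
  have he : Tendsto (fun k : ℕ => wilsonExpectation (L := L k + 1) ρ β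
      (toTorusObservable (L k + 1) fun U : LGConfig d G => ∑ i : Fin d, ∑ j : Fin d,
        if i < j then ((N : ℝ) - plaquetteObs ρ 0 i j U) else 0)) atTop
      (𝓝 (∫ U, (∑ i : Fin d, ∑ j : Fin d,
        if i < j then ((N : ℝ) - plaquetteObs ρ 0 i j U) else 0) ∂μ)) :=
    hμL.2 _ _ (isCylinder_siteEnergy ρ) (continuous_siteEnergy ρ hρ)
      (exists_abs_siteEnergy_le ρ hρ)
  have hf : ∀ y : ℝ, Tendsto (fun k : ℕ => (((L k + 1 : ℕ) : ℝ) ^ d)⁻¹ *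
      torusLogPartition d ρ y (L k + 1)) atTop (𝓝 (freeEnergyDensity d ρ y)) := fun y =>
    Tendsto.comp (hasFreeEnergyDensity_freeEnergyDensity ρ
      (exists_hasFreeEnergyDensity_holds (d := d) ρ hρ y)) hL.tendsto_atTop
  exact le_of_tendsto_of_tendsto' (he.const_mul (β - y)) ((hf y).sub (hf β)) fun k =>
    supportingLine ρ hρ β y (L k + 1)

/-- From the subgradient squeeze at tolerance `ε/2` and the subgradient inequality for `-e`:
`|β e - c| < ε`. -/
theorem abs_lt_of_subgradient {f : ℝ → ℝ} {β c ε e : ℝ} (hε : 0 < ε)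
    (hβ : ∀ p : ℝ, (∀ y : ℝ, 0 < y → f β + p * (y - β) ≤ f y) → |β * p + c| ≤ ε / 2)
    (hsub : ∀ y : ℝ, (β - y) * e ≤ f y - f β) : |β * e - c| < ε := by
  have h := hβ (-e) fun y _ => by have := hsub y; linarith
  rw [show β * -e + c = -(β * e - c) by ring, abs_neg] at h
  linarith

end Summit.QuantumFields.YangMills.Theorems.EquipartitionPinsProbe.Equipartition

namespace Summit.QuantumFields.YangMills.Theorems.EquipartitionPinsProbe

open MeasureTheory Filter Topology
open scoped BigOperators

/-- STUB 1 of line Sketch — **equipartition of the plaquette energy, uniformly over torus-limit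
states**: the free-energy hypothesis `f_r(β) + (3D/2) log β → K` forces
`β · E_μ[∑_{i<j}(N − Re tr r(U_{0,ij}))] → 3D/2` as `β → ∞`, uniformly over
`μ ∈ infiniteVolumeLimitPoints r.ρ β` (Griffiths' lemma `Equipartition.griffiths`: torus-limit
energy densities are subgradients of the convex pressure; then `subgradientLogSqueeze_proof`
with `ε/2`). Simplicity of `G` is not used. -/
theorem stub_equipartition :
    ∀ (G : Type) [Group G] [TopologicalSpace G] [IsTopologicalGroup G] [CompactSpace G],
      Literature.MathematicalPhysics.QuantumFieldTheory.IsCompactSimpleLieGroup G →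
      letI : MeasurableSpace G := borel G
      haveI : BorelSpace G := ⟨rfl⟩
      ∀ r : Literature.MathematicalPhysics.QuantumFieldTheory.LatticeRep G,
        (∃ K : ℝ, Filter.Tendsto (fun β : ℝ =>
          Literature.MathematicalPhysics.QuantumLattice.freeEnergyDensity 4 r.ρ β +
            (3 * (Module.finrank ℝ ↥(Submodule.span ℝ {X : Matrix (Fin r.N) (Fin r.N) ℂ |
              ∀ t : ℝ, NormedSpace.exp ((t : ℂ) • X) ∈ Set.range r.ρ}) : ℝ) / 2) * Real.log β)
          Filter.atTop (nhds K)) →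
        ∀ ε : ℝ, 0 < ε → ∀ᶠ β : ℝ in Filter.atTop,
          ∀ μ ∈ Literature.MathematicalPhysics.QuantumLattice.infiniteVolumeLimitPoints
              (d := 4) r.ρ β,
            |β * (∫ U, (∑ i : Fin 4, ∑ j : Fin 4,
                if i < j then ((r.N : ℝ) -
                  Literature.MathematicalPhysics.QuantumLattice.plaquetteObs r.ρ 0 i j U) else 0) ∂μ) -
              3 * (Module.finrank ℝ ↥(Submodule.span ℝ {X : Matrix (Fin r.N) (Fin r.N) ℂ |
                ∀ t : ℝ, NormedSpace.exp ((t : ℂ) • X) ∈ Set.range r.ρ}) : ℝ) / 2| < ε := by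
  intro G _ _ _ _ _hG r hK ε hε
  letI : MeasurableSpace G := borel G
  haveI : BorelSpace G := ⟨rfl⟩
  haveI : SecondCountableTopology G :=
    (r.continuous.isClosedEmbedding r.injective).isEmbedding.secondCountableTopology
  obtain ⟨K, hK⟩ := hK
  filter_upwards [Summit.QuantumFields.YangMills.Theorems.subgradientLogSqueeze_proof _ _ K hK
    (ε / 2) (half_pos hε)] with β hβ μ hμ
  exact Equipartition.abs_lt_of_subgradient hε hβ fun y =>
    Equipartition.griffiths r.ρ r.continuous hμ y

end Summit.QuantumFields.YangMills.Theorems.EquipartitionPinsProbe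

end
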